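import Literature.MathematicalPhysics.QuantumLattice.HubbardNNNHoppingOpenClusters
import HarnessLib

/-!
# Witness planes for open-cluster certificates of the `t–t'` Hubbard energy density

Ladder R1 infrastructure (certified UPPER bounds on the thermodynamic-limit ground-state energy density);
no claim on the summit is made or implied.

## Content

The open-cluster Hamiltonian `hubbardOpenBoxTT' a b t t' U` (`HubbardNNNHoppingOpenClusters.lean`) is
AFFINE in its three amplitudes:

`H_open(a,b,t,t',U) = t • H_open(a,b,1,0,0) + t' • H_open(a,b,0,1,0) + U • H_open(a,b,0,0,1)`

(`hubbardOpenBoxTT'_eq_smul_add`), the three pieces being `-T_NN` (nearest-neighbour hopping of the open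
grid), `-T_DIAG` (its diagonal bonds) and `D` (double occupancy). Consequently ONE unit `N`-particle cluster
vector `φ` whose three (four, with both signs of the diagonal piece) mean values are bounded above,

`Re⟨φ, H_open(1,0,0) φ⟩ ≤ E_K`, `Re⟨φ, H_open(0,1,0) φ⟩ ≤ E_P`, `Re⟨φ, H_open(0,-1,0) φ⟩ ≤ E_M`,
`Re⟨φ, H_open(0,0,1) φ⟩ ≤ E_D`,

certifies, through the cluster variational principle `energyDensityTT'_le_re_expect_openBox`
(Ruelle 1969 §3.3 in its zero-temperature form), a whole PLANE of upper bounds over the `(t', U ≥ 0)`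
parameter plane at the cluster's density:

`e(1, t', U, N/(ab)) ≤ (E_K + max (t' E_P) (-t' E_M) + U E_D)/(ab)`   (every real `t'`, every `U ≥ 0`)

(`energyDensityTT'_le_of_openBox_witness_planes`). This is the statement an exactly evaluated cluster state
(e.g. an integer matrix-product vector with four exact-rational one-sided Rayleigh-quotient claims) discharges
once for all `(t', U)`, instead of one certificate per parameter point.

Not here: any evaluation of a cluster state (that is the business of certificates), lower bounds, `U < 0`.
-/

noncomputable section

open Matrix Finset
open scoped ComplexOrder BigOperators

namespace Literature.MathematicalPhysics.QuantumLattice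

namespace ThermodynamicLimit

variable {a b : ℕ}

/-- The open-cluster `t–t'` Hamiltonian is affine in its amplitudes:
`H_open(a,b,t,t',U) = t • H_open(a,b,1,0,0) + t' • H_open(a,b,0,1,0) + U • H_open(a,b,0,0,1)`
(the three pieces are `-T_NN`, `-T_DIAG`, `D`) — the model of LeBlanc et al. (2015) eq. (1) on an open cluster,
read as a function of its couplings. [cite: LeBlancEtAl2015, eq. (1)] -/
theorem hubbardOpenBoxTT'_eq_smul_add (a b : ℕ) (t t' U : ℝ) :
    hubbardOpenBoxTT' a b t t' U =
      (t : ℂ) • hubbardOpenBoxTT' a b 1 0 0 + (t' : ℂ) • hubbardOpenBoxTT' a b 0 1 0 +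
        (U : ℂ) • hubbardOpenBoxTT' a b 0 0 1 := by
  simp only [hubbardOpenBoxTT', hamiltonian, Complex.ofReal_one, Complex.ofReal_zero, zero_smul, add_zero,
    one_smul, neg_smul, smul_add, smul_neg, smul_zero]
  abel

/-- The diagonal piece changes sign with its amplitude: `H_open(a,b,0,-1,0) = -H_open(a,b,0,1,0)`
(LeBlanc et al. (2015) eq. (1): the `t'`-term enters linearly). [cite: LeBlancEtAl2015, eq. (1)] -/
theorem hubbardOpenBoxTT'_zero_neg_one_zero (a b : ℕ) :
    hubbardOpenBoxTT' a b 0 (-1) 0 = -hubbardOpenBoxTT' a b 0 1 0 := by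
  rw [hubbardOpenBoxTT'_eq_smul_add a b 0 (-1) 0, hubbardOpenBoxTT'_eq_smul_add a b 0 1 0]
  simp only [Complex.ofReal_zero, Complex.ofReal_one, Complex.ofReal_neg, zero_smul, zero_add, add_zero,
    one_smul, neg_smul]

/-- The real part of a cluster mean value is affine in the amplitudes:
`Re⟨φ, H_open(1,t',U) φ⟩ = Re⟨φ, H_open(1,0,0) φ⟩ + t' Re⟨φ, H_open(0,1,0) φ⟩ + U Re⟨φ, H_open(0,0,1) φ⟩`
(LeBlanc et al. (2015) eq. (1) read term by term in a fixed state). [cite: LeBlancEtAl2015, eq. (1)] -/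
theorem re_expect_hubbardOpenBoxTT'_eq (a b : ℕ) (t' U : ℝ) (φ : Fock (Orb (Fin a ×ₗ Fin b))) :
    (star φ ⬝ᵥ (hubbardOpenBoxTT' a b 1 t' U *ᵥ φ)).re =
      (star φ ⬝ᵥ (hubbardOpenBoxTT' a b 1 0 0 *ᵥ φ)).re +
        t' * (star φ ⬝ᵥ (hubbardOpenBoxTT' a b 0 1 0 *ᵥ φ)).re +
          U * (star φ ⬝ᵥ (hubbardOpenBoxTT' a b 0 0 1 *ᵥ φ)).re := by
  rw [hubbardOpenBoxTT'_eq_smul_add a b 1 t' U]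
  simp only [Complex.ofReal_one, one_smul, add_mulVec, smul_mulVec, dotProduct_add, dotProduct_smul,
    smul_eq_mul, Complex.add_re, Complex.re_ofReal_mul]

/-- **Witness planes for open-cluster certificates.** One unit `N`-particle vector `φ` of the open
`a × b` cluster with `Re⟨φ, H_open(a,b,1,0,0) φ⟩ ≤ E_K`, `Re⟨φ, H_open(a,b,0,1,0) φ⟩ ≤ E_P`,
`Re⟨φ, H_open(a,b,0,-1,0) φ⟩ ≤ E_M` and `Re⟨φ, H_open(a,b,0,0,1) φ⟩ ≤ E_D` certifies, for EVERY real `t'`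
and EVERY `U ≥ 0`, `e(1, t', U, N/(ab)) ≤ (E_K + max (t' E_P) (-t' E_M) + U E_D)/(ab)` — the cluster
variational principle (Ruelle 1969 §3.3, zero-temperature form `energyDensityTT'_le_re_expect_openBox`)
combined with the affine structure of `H_open` in `(t, t', U)`. [cite: Ruelle1969, §3.3] -/
theorem energyDensityTT'_le_of_openBox_witness_planes {U : ℝ} (hU : 0 ≤ U) (ha : 1 ≤ a) (hb : 1 ≤ b)
    {N : ℕ} (hN : N < 2 * (a * b)) {φ : Fock (Orb (Fin a ×ₗ Fin b))} (hφN : IsNParticle N φ)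
    (hφ1 : star φ ⬝ᵥ φ = 1) {EK EP EM ED : ℝ}
    (hK : (star φ ⬝ᵥ (hubbardOpenBoxTT' a b 1 0 0 *ᵥ φ)).re ≤ EK)
    (hP : (star φ ⬝ᵥ (hubbardOpenBoxTT' a b 0 1 0 *ᵥ φ)).re ≤ EP)
    (hM : (star φ ⬝ᵥ (hubbardOpenBoxTT' a b 0 (-1) 0 *ᵥ φ)).re ≤ EM)
    (hD : (star φ ⬝ᵥ (hubbardOpenBoxTT' a b 0 0 1 *ᵥ φ)).re ≤ ED) (t' : ℝ) :
    energyDensityTT' 1 t' U ((N : ℝ) / ((a : ℝ) * (b : ℝ))) ≤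
      (EK + max (t' * EP) (-t' * EM) + U * ED) / ((a : ℝ) * (b : ℝ)) := by
  refine (energyDensityTT'_le_re_expect_openBox 1 t' hU ha hb hN hφN hφ1).trans ?_
  have hab : (0 : ℝ) < (a : ℝ) * (b : ℝ) := by
    have ha' : (0 : ℝ) < a := by exact_mod_cast ha
    have hb' : (0 : ℝ) < b := by exact_mod_cast hb
    positivity
  refine div_le_div_of_nonneg_right ?_ hab.le
  rw [re_expect_hubbardOpenBoxTT'_eq a b t' U φ]
  -- the diagonal piece: `t' X ≤ max (t' E_P) (-t' E_M)` from `X ≤ E_P` and `-X ≤ E_M`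
  set X := (star φ ⬝ᵥ (hubbardOpenBoxTT' a b 0 1 0 *ᵥ φ)).re with hX
  have hnegX : -X ≤ EM := by
    have h := hM
    rw [hubbardOpenBoxTT'_zero_neg_one_zero, neg_mulVec, dotProduct_neg, Complex.neg_re] at h
    exact h
  have hdiag : t' * X ≤ max (t' * EP) (-t' * EM) := by
    rcases le_or_gt 0 t' with ht | ht
    · exact (mul_le_mul_of_nonneg_left hP ht).trans (le_max_left _ _)
    · have : t' * X = (-t') * (-X) := by ring
      rw [this]
      exact (mul_le_mul_of_nonneg_left hnegX (by linarith)).trans (le_max_right _ _)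
  have hdocc : U * (star φ ⬝ᵥ (hubbardOpenBoxTT' a b 0 0 1 *ᵥ φ)).re ≤ U * ED :=
    mul_le_mul_of_nonneg_left hD hU
  linarith

/-- The same plane with the diagonal piece bounded on ONE side only, for `t' ≥ 0`:
`e(1, t', U, N/(ab)) ≤ (E_K + t' E_P + U E_D)/(ab)`. [cite: Ruelle1969, §3.3] -/
theorem energyDensityTT'_le_of_openBox_witness_plane_nonneg {U : ℝ} (hU : 0 ≤ U) (ha : 1 ≤ a)
    (hb : 1 ≤ b) {N : ℕ} (hN : N < 2 * (a * b)) {φ : Fock (Orb (Fin a ×ₗ Fin b))}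
    (hφN : IsNParticle N φ) (hφ1 : star φ ⬝ᵥ φ = 1) {EK EP ED : ℝ}
    (hK : (star φ ⬝ᵥ (hubbardOpenBoxTT' a b 1 0 0 *ᵥ φ)).re ≤ EK)
    (hP : (star φ ⬝ᵥ (hubbardOpenBoxTT' a b 0 1 0 *ᵥ φ)).re ≤ EP)
    (hD : (star φ ⬝ᵥ (hubbardOpenBoxTT' a b 0 0 1 *ᵥ φ)).re ≤ ED) {t' : ℝ} (ht' : 0 ≤ t') :
    energyDensityTT' 1 t' U ((N : ℝ) / ((a : ℝ) * (b : ℝ))) ≤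
      (EK + t' * EP + U * ED) / ((a : ℝ) * (b : ℝ)) := by
  refine (energyDensityTT'_le_re_expect_openBox 1 t' hU ha hb hN hφN hφ1).trans ?_
  have hab : (0 : ℝ) < (a : ℝ) * (b : ℝ) := by
    have ha' : (0 : ℝ) < a := by exact_mod_cast ha
    have hb' : (0 : ℝ) < b := by exact_mod_cast hb
    positivity
  refine div_le_div_of_nonneg_right ?_ hab.le
  rw [re_expect_hubbardOpenBoxTT'_eq a b t' U φ]
  have h1 : t' * (star φ ⬝ᵥ (hubbardOpenBoxTT' a b 0 1 0 *ᵥ φ)).re ≤ t' * EP :=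
    mul_le_mul_of_nonneg_left hP ht'
  have h2 : U * (star φ ⬝ᵥ (hubbardOpenBoxTT' a b 0 0 1 *ᵥ φ)).re ≤ U * ED :=
    mul_le_mul_of_nonneg_left hD hU
  linarith

/-- … and for `t' ≤ 0` with the opposite-sign diagonal piece:
`e(1, t', U, N/(ab)) ≤ (E_K + (-t') E_M + U E_D)/(ab)`. [cite: Ruelle1969, §3.3] -/
theorem energyDensityTT'_le_of_openBox_witness_plane_nonpos {U : ℝ} (hU : 0 ≤ U) (ha : 1 ≤ a)
    (hb : 1 ≤ b) {N : ℕ} (hN : N < 2 * (a * b)) {φ : Fock (Orb (Fin a ×ₗ Fin b))}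
    (hφN : IsNParticle N φ) (hφ1 : star φ ⬝ᵥ φ = 1) {EK EM ED : ℝ}
    (hK : (star φ ⬝ᵥ (hubbardOpenBoxTT' a b 1 0 0 *ᵥ φ)).re ≤ EK)
    (hM : (star φ ⬝ᵥ (hubbardOpenBoxTT' a b 0 (-1) 0 *ᵥ φ)).re ≤ EM)
    (hD : (star φ ⬝ᵥ (hubbardOpenBoxTT' a b 0 0 1 *ᵥ φ)).re ≤ ED) {t' : ℝ} (ht' : t' ≤ 0) :
    energyDensityTT' 1 t' U ((N : ℝ) / ((a : ℝ) * (b : ℝ))) ≤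
      (EK + (-t') * EM + U * ED) / ((a : ℝ) * (b : ℝ)) := by
  refine (energyDensityTT'_le_re_expect_openBox 1 t' hU ha hb hN hφN hφ1).trans ?_
  have hab : (0 : ℝ) < (a : ℝ) * (b : ℝ) := by
    have ha' : (0 : ℝ) < a := by exact_mod_cast ha
    have hb' : (0 : ℝ) < b := by exact_mod_cast hb
    positivity
  refine div_le_div_of_nonneg_right ?_ hab.le
  rw [re_expect_hubbardOpenBoxTT'_eq a b t' U φ]
  set X := (star φ ⬝ᵥ (hubbardOpenBoxTT' a b 0 1 0 *ᵥ φ)).re with hX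
  have hnegX : -X ≤ EM := by
    have h := hM
    rw [hubbardOpenBoxTT'_zero_neg_one_zero, neg_mulVec, dotProduct_neg, Complex.neg_re] at h
    exact h
  have h1 : t' * X ≤ (-t') * EM := by
    have : t' * X = (-t') * (-X) := by ring
    rw [this]; exact mul_le_mul_of_nonneg_left hnegX (by linarith)
  have h2 : U * (star φ ⬝ᵥ (hubbardOpenBoxTT' a b 0 0 1 *ᵥ φ)).re ≤ U * ED :=
    mul_le_mul_of_nonneg_left hD hU
  linarith

/-! ### One number per CELL: the plane cap over a `(t', U)` rectangle is attained at a corner -/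

/-- An affine function of `U` over a segment is below its endpoint maximum:
`U·D ≤ max (U₁·D) (U₂·D)` for `U₁ ≤ U ≤ U₂`. [folklore] -/
private theorem mul_le_max_endpoints {U U₁ U₂ D : ℝ} (h₁ : U₁ ≤ U) (h₂ : U ≤ U₂) :
    U * D ≤ max (U₁ * D) (U₂ * D) := by
  rcases le_total 0 D with hD | hD
  · exact (mul_le_mul_of_nonneg_right h₂ hD).trans (le_max_right _ _)
  · exact (mul_le_mul_of_nonpos_right h₁ hD).trans (le_max_left _ _)

/-- **The witness plane is convex piecewise-affine in `(t', U)`, so ONE number caps a whole cell**: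
for `s₁ ≤ t' ≤ s₂` and `U₁ ≤ U ≤ U₂`,
`E_K + max (t' E_P) (−t' E_M) + U E_D ≤ E_K + max (max (s₁E_P) (s₂E_P)) (max (−s₁E_M) (−s₂E_M)) + max (U₁E_D) (U₂E_D)`
(each sign-split slope term attains its maximum over a segment at an endpoint; Israel (1979)
Thm I.3.4 is the convexity behind the tangent-plane bookkeeping). [cite: Israel1979, Thm. I.3.4] -/
theorem witnessPlane_le_cornerMax {EK EP EM ED s₁ s₂ U₁ U₂ t' U : ℝ} (hs₁ : s₁ ≤ t') (hs₂ : t' ≤ s₂)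
    (hU₁ : U₁ ≤ U) (hU₂ : U ≤ U₂) :
    EK + max (t' * EP) (-t' * EM) + U * ED ≤
      EK + max (max (s₁ * EP) (s₂ * EP)) (max (-s₁ * EM) (-s₂ * EM)) + max (U₁ * ED) (U₂ * ED) := by
  have h1 : t' * EP ≤ max (s₁ * EP) (s₂ * EP) := mul_le_max_endpoints hs₁ hs₂
  have h2 : -t' * EM ≤ max (-s₁ * EM) (-s₂ * EM) := by
    have h := mul_le_max_endpoints (D := EM) (neg_le_neg hs₂) (neg_le_neg hs₁)
    rwa [max_comm] at h
  have h3 : U * ED ≤ max (U₁ * ED) (U₂ * ED) := mul_le_max_endpoints hU₁ hU₂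
  have h12 : max (t' * EP) (-t' * EM) ≤ max (max (s₁ * EP) (s₂ * EP)) (max (-s₁ * EM) (-s₂ * EM)) :=
    max_le_max h1 h2
  linarith

/-- **Cell cap from four witness planes.** Under the hypotheses of
`energyDensityTT'_le_of_openBox_witness_planes` (unit `N`-particle open-cluster witness with pieces
`E_K, E_P, E_M, E_D`), EVERY point of a rectangle `[s₁, s₂] × [U₁, U₂]` with `U₁ ≥ 0` satisfies
`e(1, t', U, N/(ab)) ≤ (E_K + max (max (s₁E_P) (s₂E_P)) (max (−s₁E_M) (−s₂E_M)) + max (U₁E_D) (U₂E_D))/(ab)`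
— the number a cell-table ("box word" ceiling) consumes. [cite: Ruelle1969, §3.3] -/
theorem energyDensityTT'_le_cornerMax_of_openBox_witness_planes {U₁ U₂ s₁ s₂ : ℝ} (hU₁ : 0 ≤ U₁)
    (ha : 1 ≤ a) (hb : 1 ≤ b) {N : ℕ} (hN : N < 2 * (a * b)) {φ : Fock (Orb (Fin a ×ₗ Fin b))}
    (hφN : IsNParticle N φ) (hφ1 : star φ ⬝ᵥ φ = 1) {EK EP EM ED : ℝ}
    (hK : (star φ ⬝ᵥ (hubbardOpenBoxTT' a b 1 0 0 *ᵥ φ)).re ≤ EK)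
    (hP : (star φ ⬝ᵥ (hubbardOpenBoxTT' a b 0 1 0 *ᵥ φ)).re ≤ EP)
    (hM : (star φ ⬝ᵥ (hubbardOpenBoxTT' a b 0 (-1) 0 *ᵥ φ)).re ≤ EM)
    (hD : (star φ ⬝ᵥ (hubbardOpenBoxTT' a b 0 0 1 *ᵥ φ)).re ≤ ED)
    {t' U : ℝ} (hs₁ : s₁ ≤ t') (hs₂ : t' ≤ s₂) (hU₁' : U₁ ≤ U) (hU₂ : U ≤ U₂) :
    energyDensityTT' 1 t' U ((N : ℝ) / ((a : ℝ) * (b : ℝ))) ≤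
      (EK + max (max (s₁ * EP) (s₂ * EP)) (max (-s₁ * EM) (-s₂ * EM)) + max (U₁ * ED) (U₂ * ED)) /
        ((a : ℝ) * (b : ℝ)) := by
  refine (energyDensityTT'_le_of_openBox_witness_planes (hU₁.trans hU₁') ha hb hN hφN hφ1 hK hP hM
    hD t').trans ?_
  have hab : (0 : ℝ) ≤ (a : ℝ) * (b : ℝ) := by positivity
  exact div_le_div_of_nonneg_right (witnessPlane_le_cornerMax hs₁ hs₂ hU₁' hU₂) hab

/-! ### The plane-certificate CLAIM in the certificate's own currency (homogeneous, integer vector)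

A plane certificate (FORMAT-mps1 class) checks, for ONE number-definite cluster vector `χ` given by exact
(integer / rational) tensors, four inequalities of the shape `Re⟨χ, H_piece χ⟩ ≤ E_piece · Re⟨χ, χ⟩` — no
normalisation is ever performed. The statements below consume exactly that shape (Lieb 1989: Rayleigh
quotients in a sector of fixed particle number; Ruelle 1969 §3.3: the cluster bound), so a certificate
module can state its claim node as `openBoxPlaneClaim a b N E_K E_P E_M E_D` and cite the transports by
name. -/

/-- **Witness planes, homogeneous form.** For ANY `N`-particle vector `χ` of the open `a × b` cluster
(no normalisation, `χ = 0` allowed) whose four pieces obey `Re⟨χ,H_open(1,0,0)χ⟩ ≤ E_K·Re⟨χ,χ⟩`,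
`Re⟨χ,H_open(0,1,0)χ⟩ ≤ E_P·Re⟨χ,χ⟩`, `Re⟨χ,H_open(0,-1,0)χ⟩ ≤ E_M·Re⟨χ,χ⟩`, `Re⟨χ,H_open(0,0,1)χ⟩ ≤ E_D·Re⟨χ,χ⟩`:
`ab · e(1, t', U, N/(ab)) · Re⟨χ,χ⟩ ≤ (E_K + max (t' E_P) (-t' E_M) + U E_D) · Re⟨χ,χ⟩` for every real `t'`,
`U ≥ 0` (cluster bound, Ruelle 1969 §3.3, with the sector Rayleigh quotient `LiebThm1.groundEnergy_mul_norm_le`).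
[cite: Ruelle1969, §3.3] -/
theorem energyDensityTT'_mul_norm_le_of_openBox_witness_planes {U : ℝ} (hU : 0 ≤ U) (ha : 1 ≤ a)
    (hb : 1 ≤ b) {N : ℕ} (hN : N < 2 * (a * b)) {χ : Fock (Orb (Fin a ×ₗ Fin b))} (hχN : IsNParticle N χ)
    {EK EP EM ED : ℝ}
    (hK : (star χ ⬝ᵥ (hubbardOpenBoxTT' a b 1 0 0 *ᵥ χ)).re ≤ EK * (star χ ⬝ᵥ χ).re)
    (hP : (star χ ⬝ᵥ (hubbardOpenBoxTT' a b 0 1 0 *ᵥ χ)).re ≤ EP * (star χ ⬝ᵥ χ).re)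
    (hM : (star χ ⬝ᵥ (hubbardOpenBoxTT' a b 0 (-1) 0 *ᵥ χ)).re ≤ EM * (star χ ⬝ᵥ χ).re)
    (hD : (star χ ⬝ᵥ (hubbardOpenBoxTT' a b 0 0 1 *ᵥ χ)).re ≤ ED * (star χ ⬝ᵥ χ).re) (t' : ℝ) :
    ((a : ℝ) * (b : ℝ)) * energyDensityTT' 1 t' U ((N : ℝ) / ((a : ℝ) * (b : ℝ))) * (star χ ⬝ᵥ χ).re ≤
      (EK + max (t' * EP) (-t' * EM) + U * ED) * (star χ ⬝ᵥ χ).re := by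
  have hab : (0 : ℝ) < (a : ℝ) * (b : ℝ) := by
    have ha' : (0 : ℝ) < a := by exact_mod_cast ha
    have hb' : (0 : ℝ) < b := by exact_mod_cast hb
    positivity
  have hnorm : 0 ≤ (star χ ⬝ᵥ χ).re := (Complex.nonneg_iff.1 (dotProduct_star_self_nonneg χ)).1
  -- cluster bound `ab · e ≤ E(cluster, N)` and the sector Rayleigh quotient `E · ⟨χ,χ⟩ ≤ Re⟨χ,Hχ⟩`
  have hTL := energyDensityTT'_le_openBox 1 t' hU ha hb hN
  have h1 : ((a : ℝ) * (b : ℝ)) * energyDensityTT' 1 t' U ((N : ℝ) / ((a : ℝ) * (b : ℝ))) ≤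
      groundEnergy (hubbardOpenBoxTT' a b 1 t' U) N := by
    rw [le_div_iff₀ hab] at hTL
    linarith
  have hRR := LiebThm1.groundEnergy_mul_norm_le (hubbardOpenBoxTT' a b 1 t' U) hχN
  rw [expect, re_expect_hubbardOpenBoxTT'_eq a b t' U χ] at hRR
  -- the diagonal piece: `t' X ≤ max (t' E_P) (-t' E_M) · ⟨χ,χ⟩` from the two one-sided bounds
  set X := (star χ ⬝ᵥ (hubbardOpenBoxTT' a b 0 1 0 *ᵥ χ)).re with hX
  have hnegX : -X ≤ EM * (star χ ⬝ᵥ χ).re := by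
    have h := hM
    rw [hubbardOpenBoxTT'_zero_neg_one_zero, neg_mulVec, dotProduct_neg, Complex.neg_re] at h
    exact h
  have hdiag : t' * X ≤ max (t' * EP) (-t' * EM) * (star χ ⬝ᵥ χ).re := by
    rcases le_or_gt 0 t' with ht | ht
    · calc t' * X ≤ t' * (EP * (star χ ⬝ᵥ χ).re) := mul_le_mul_of_nonneg_left hP ht
        _ = (t' * EP) * (star χ ⬝ᵥ χ).re := by ring
        _ ≤ max (t' * EP) (-t' * EM) * (star χ ⬝ᵥ χ).re :=
          mul_le_mul_of_nonneg_right (le_max_left _ _) hnorm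
    · calc t' * X = (-t') * (-X) := by ring
        _ ≤ (-t') * (EM * (star χ ⬝ᵥ χ).re) := mul_le_mul_of_nonneg_left hnegX (by linarith)
        _ = (-t' * EM) * (star χ ⬝ᵥ χ).re := by ring
        _ ≤ max (t' * EP) (-t' * EM) * (star χ ⬝ᵥ χ).re :=
          mul_le_mul_of_nonneg_right (le_max_right _ _) hnorm
  have hdocc : U * (star χ ⬝ᵥ (hubbardOpenBoxTT' a b 0 0 1 *ᵥ χ)).re ≤ U * (ED * (star χ ⬝ᵥ χ).re) :=
    mul_le_mul_of_nonneg_left hD hU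
  have h2 := (mul_le_mul_of_nonneg_right h1 hnorm).trans hRR
  nlinarith [h2, hdiag, hdocc, hK]

/-- **The plane-certificate claim node** of an open `a × b` cluster at particle number `N` with pieces
`(E_K, E_P, E_M, E_D)`, in the certificate's own currency: SOME `N`-particle cluster vector `χ` of positive
norm with `Re⟨χ,H_open(1,0,0)χ⟩ ≤ E_K·Re⟨χ,χ⟩`, `Re⟨χ,H_open(0,1,0)χ⟩ ≤ E_P·Re⟨χ,χ⟩`,
`Re⟨χ,H_open(0,-1,0)χ⟩ ≤ E_M·Re⟨χ,χ⟩`, `Re⟨χ,H_open(0,0,1)χ⟩ ≤ E_D·Re⟨χ,χ⟩` (Lieb 1989: fixed-`N` Rayleigh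
quotients; this is what an exact-rational evaluation of an integer matrix-product vector certifies).
[cite: LiebPRL1989, proof of Theorem 1] -/
def openBoxPlaneClaim (a b N : ℕ) (EK EP EM ED : ℝ) : Prop :=
  ∃ χ : Fock (Orb (Fin a ×ₗ Fin b)), IsNParticle N χ ∧ 0 < (star χ ⬝ᵥ χ).re ∧
    (star χ ⬝ᵥ (hubbardOpenBoxTT' a b 1 0 0 *ᵥ χ)).re ≤ EK * (star χ ⬝ᵥ χ).re ∧
    (star χ ⬝ᵥ (hubbardOpenBoxTT' a b 0 1 0 *ᵥ χ)).re ≤ EP * (star χ ⬝ᵥ χ).re ∧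
    (star χ ⬝ᵥ (hubbardOpenBoxTT' a b 0 (-1) 0 *ᵥ χ)).re ≤ EM * (star χ ⬝ᵥ χ).re ∧
    (star χ ⬝ᵥ (hubbardOpenBoxTT' a b 0 0 1 *ᵥ χ)).re ≤ ED * (star χ ⬝ᵥ χ).re

/-- A claim node is MONOTONE in its four numbers (outward rounding: replacing the certified dyadics by
larger printed decimals keeps the claim) — an upper bound on a fixed-`N` Rayleigh quotient stays one under
weakening (Lieb 1989, proof of Thm 1, the sector variational principle). [cite: LiebPRL1989, proof of Theorem 1] -/
theorem openBoxPlaneClaim.mono {N : ℕ} {EK EP EM ED EK' EP' EM' ED' : ℝ} (hK : EK ≤ EK') (hP : EP ≤ EP')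
    (hM : EM ≤ EM') (hD : ED ≤ ED') (h : openBoxPlaneClaim a b N EK EP EM ED) :
    openBoxPlaneClaim a b N EK' EP' EM' ED' := by
  obtain ⟨χ, hχN, hpos, h1, h2, h3, h4⟩ := h
  exact ⟨χ, hχN, hpos, h1.trans (mul_le_mul_of_nonneg_right hK hpos.le),
    h2.trans (mul_le_mul_of_nonneg_right hP hpos.le), h3.trans (mul_le_mul_of_nonneg_right hM hpos.le),
    h4.trans (mul_le_mul_of_nonneg_right hD hpos.le)⟩

/-- The UNIT-VECTOR node shape (a unit `N`-particle `φ` with the four plain mean-value bounds, as in the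
hypotheses of `energyDensityTT'_le_of_openBox_witness_planes`) gives the claim node: for `⟨φ,φ⟩ = 1` the
homogeneous and the normalised fixed-`N` Rayleigh-quotient bounds coincide (Lieb 1989, proof of Thm 1).
[cite: LiebPRL1989, proof of Theorem 1] -/
theorem openBoxPlaneClaim_of_unit {N : ℕ} {EK EP EM ED : ℝ} {φ : Fock (Orb (Fin a ×ₗ Fin b))}
    (hφN : IsNParticle N φ) (hφ1 : star φ ⬝ᵥ φ = 1)
    (hK : (star φ ⬝ᵥ (hubbardOpenBoxTT' a b 1 0 0 *ᵥ φ)).re ≤ EK)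
    (hP : (star φ ⬝ᵥ (hubbardOpenBoxTT' a b 0 1 0 *ᵥ φ)).re ≤ EP)
    (hM : (star φ ⬝ᵥ (hubbardOpenBoxTT' a b 0 (-1) 0 *ᵥ φ)).re ≤ EM)
    (hD : (star φ ⬝ᵥ (hubbardOpenBoxTT' a b 0 0 1 *ᵥ φ)).re ≤ ED) :
    openBoxPlaneClaim a b N EK EP EM ED := by
  refine ⟨φ, hφN, ?_, ?_, ?_, ?_, ?_⟩ <;> simp only [hφ1, Complex.one_re, mul_one, zero_lt_one]
  · exact hK
  · exact hP
  · exact hM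
  · exact hD

/-- **PLANE from the claim node, BY NAME**: `openBoxPlaneClaim a b N E_K E_P E_M E_D` gives, for every real
`t'` and every `U ≥ 0`, `e(1, t', U, N/(ab)) ≤ (E_K + max (t' E_P) (-t' E_M) + U E_D)/(ab)`
(Ruelle 1969 §3.3 cluster bound; homogeneous form divided by the positive norm). [cite: Ruelle1969, §3.3] -/
theorem openBoxPlaneClaim.plane {N : ℕ} {EK EP EM ED : ℝ} (h : openBoxPlaneClaim a b N EK EP EM ED)
    {U : ℝ} (hU : 0 ≤ U) (ha : 1 ≤ a) (hb : 1 ≤ b) (hN : N < 2 * (a * b)) (t' : ℝ) :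
    energyDensityTT' 1 t' U ((N : ℝ) / ((a : ℝ) * (b : ℝ))) ≤
      (EK + max (t' * EP) (-t' * EM) + U * ED) / ((a : ℝ) * (b : ℝ)) := by
  obtain ⟨χ, hχN, hpos, hK, hP, hM, hD⟩ := h
  have hab : (0 : ℝ) < (a : ℝ) * (b : ℝ) := by
    have ha' : (0 : ℝ) < a := by exact_mod_cast ha
    have hb' : (0 : ℝ) < b := by exact_mod_cast hb
    positivity
  have h := energyDensityTT'_mul_norm_le_of_openBox_witness_planes hU ha hb hN hχN hK hP hM hD t'
  rw [le_div_iff₀ hab]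
  have h' : (energyDensityTT' 1 t' U ((N : ℝ) / ((a : ℝ) * (b : ℝ))) * ((a : ℝ) * (b : ℝ))) *
      (star χ ⬝ᵥ χ).re ≤ (EK + max (t' * EP) (-t' * EM) + U * ED) * (star χ ⬝ᵥ χ).re := by
    calc _ = ((a : ℝ) * (b : ℝ)) * energyDensityTT' 1 t' U ((N : ℝ) / ((a : ℝ) * (b : ℝ))) *
          (star χ ⬝ᵥ χ).re := by ring
      _ ≤ _ := h
  exact le_of_mul_le_mul_right h' hpos

/-- **CELL CAP from the claim node, BY NAME**: on a rectangle `s₁ ≤ t' ≤ s₂`, `0 ≤ U₁ ≤ U ≤ U₂`,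
`e(1, t', U, N/(ab)) ≤ (E_K + max (max (s₁E_P) (s₂E_P)) (max (-s₁E_M) (-s₂E_M)) + max (U₁E_D) (U₂E_D))/(ab)`
(the plane is convex piecewise-affine in `(t', U)`, `witnessPlane_le_cornerMax`; Israel 1979 Thm I.3.4).
[cite: Ruelle1969, §3.3] [cite: Israel1979, Thm. I.3.4] -/
theorem openBoxPlaneClaim.cellCap {N : ℕ} {EK EP EM ED : ℝ} (h : openBoxPlaneClaim a b N EK EP EM ED)
    {U₁ U₂ s₁ s₂ : ℝ} (hU₁ : 0 ≤ U₁) (ha : 1 ≤ a) (hb : 1 ≤ b) (hN : N < 2 * (a * b)) {t' U : ℝ}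
    (hs₁ : s₁ ≤ t') (hs₂ : t' ≤ s₂) (hU₁' : U₁ ≤ U) (hU₂ : U ≤ U₂) :
    energyDensityTT' 1 t' U ((N : ℝ) / ((a : ℝ) * (b : ℝ))) ≤
      (EK + max (max (s₁ * EP) (s₂ * EP)) (max (-s₁ * EM) (-s₂ * EM)) + max (U₁ * ED) (U₂ * ED)) /
        ((a : ℝ) * (b : ℝ)) := by
  refine (h.plane (hU₁.trans hU₁') ha hb hN t').trans ?_
  have hab : (0 : ℝ) ≤ (a : ℝ) * (b : ℝ) := by positivity
  exact div_le_div_of_nonneg_right (witnessPlane_le_cornerMax hs₁ hs₂ hU₁' hU₂) hab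

end ThermodynamicLimit

end Literature.MathematicalPhysics.QuantumLattice

end
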